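import Literature.NumberTheory.Automorphic.ArthurClozelNormMapRational
import HarnessLib

/-!
# Lemma 1.1 (i) of Arthur–Clozel for cyclic extensions of arbitrary degree

Arthur–Clozel, *Simple algebras, base change, and the advanced theory of the trace formula*,
Ann. of Math. Stud. 120 (1989), Ch. 1, §1, Lemma 1.1 (i): *for a cyclic extension `E / F` with
`Gal(E/F) = ⟨σ⟩` of order `ℓ` ("we do not assume that `ℓ` is prime") and `x ∈ GL_n(E)`, the norm
`N x = x x^σ ⋯ x^{σ^{ℓ-1}}` is conjugate in `GL_n(E)` to an element of `GL_n(F)`.*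

`Literature.NumberTheory.Automorphic.ArthurClozelNormMapRational` proves this for `ℓ` prime
(`ArthurClozel.exists_isConj_map_algebraMap_normMap`, with a `TODO(general form)`); this file
removes the primality assumption (`exists_isConj_map_algebraMap_normMap_of_isGalois`), completing
Lemma 1.1 as printed (the uniqueness clause and part (ii) being
`ArthurClozel.isConj_of_isConj_map_algebraMap` and `ArthurClozel.isSigmaConj_of_isConj_normMap`).

## The argument

As in the prime case, `u = N x` is the `ℓ`-th iterate of the bijective `σ`-semilinear map
`φ = x ∘ σ` of `Eⁿ`, which commutes with `u`, and one shows that such a `T = φ^ℓ` is *rational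
over `F`* (`isRationalEnd_of_semilinear_of_isGalois`). By the Fitting step of the prime file one
reduces to `W = ker G(T)^k` for `G = ∏_{j<d} q^{σ^j}`, where `q` is a monic irreducible factor of
the minimal polynomial of `T` and **`d` is the period of `q` under `σ`** (`exists_period`:
`q^{σ^a} = q ↔ d ∣ a`; `d ∣ ℓ`, and the conjugates `q^{σ^j}`, `j < d`, are pairwise distinct,
`map_pow_injective_of_period`). The prime case only met `d = 1` or `d = ℓ`; in general:

* `q` has coefficients in the fixed field `E₁ = E^{σ^d}`, of degree `d` over `F`
  (`exists_intermediateField_of_dvd`, Galois correspondence), so by the structure theorem over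
  `E[X]` (the "fixed block" of the prime file, `isRationalEnd_of_aeval_pow_eq_zero`, applied over
  the base field `E₁`) `M₀ = ker q(T)^k` has an `E`-basis `b` in which `T` has entries in `E₁`;
* `M_j = ker q^{σ^j}(T)^k = φ^j(M₀)` for `j < d`, and with an `F`-basis `ε₁, …, ε_d` of `E₁` the
  vectors `β'_{k,i} = ∑_{j<d} σ^j(ε_k) φ^j(b_i)` form an `E`-basis of `⊕_{j<d} M_j` with
  `T`-stable `F`-span (`exists_span_eq_ker_prod_conj_of_intermediateField`): the Moore matrix
  `(σ^j(ε_k))_{j,k<d}` is invertible by Dedekind's independence of the `d` distinct embeddings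
  `σ^j|_{E₁} : E₁ → E` (`det_moore_ne_zero_of_intermediateField`), and
  `T β'_{k,i} = ∑_j ∑_{i'} σ^j(ε_k U_{i'i}) φ^j(b_{i'})` with `ε_k U_{i'i} ∈ E₁ = ⊕ F ε_m`.

No induction over the tower `F ⊂ E₁ ⊂ E` is needed. All statements are theorems; no named facts
are introduced.

## References
* J. Arthur, L. Clozel, *Simple algebras, base change, and the advanced theory of the trace
  formula*, Ann. of Math. Stud. 120 (1989), Ch. 1, §1, Lemma 1.1.
* R. P. Langlands, *Base change for `GL(2)`*, Ann. of Math. Stud. 96 (1980), §4.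
-/

open Polynomial Module

namespace Literature.NumberTheory.Automorphic

namespace ArthurClozel

variable {F E : Type*} [Field F] [Field E] [Algebra F E]

/-! ### The period of a polynomial under `σ` -/

section Period

variable {σ : E ≃ₐ[F] E}

/-- If `q^{σ^t} = q` then `q^{σ^{t x}} = q`. [folklore] -/
theorem map_pow_mul_eq_self {q : E[X]} {t : ℕ}
    (ht : q.map ((σ ^ t : E ≃ₐ[F] E) : E →+* E) = q) (x : ℕ) :
    q.map ((σ ^ (t * x) : E ≃ₐ[F] E) : E →+* E) = q := by
  induction x with
  | zero => rw [mul_zero]; exact map_pow_zero σ q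
  | succ x ih =>
    rw [Nat.mul_succ, ← map_pow_map_pow σ q t (t * x), ht]
    exact ih

/-- **The period of `q` under `σ`.** If `σ^ℓ = 1` with `0 < ℓ`, there is `d > 0` such that
`q^{σ^a} = q` exactly when `d ∣ a` (the least positive period; in particular `d ∣ ℓ`).
[folklore] -/
theorem exists_period {ℓ : ℕ} (hσℓ : σ ^ ℓ = 1) (hℓ : 0 < ℓ) (q : E[X]) :
    ∃ d : ℕ, 0 < d ∧ ∀ a : ℕ, q.map ((σ ^ a : E ≃ₐ[F] E) : E →+* E) = q ↔ d ∣ a := by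
  classical
  have hP : ∃ d, 0 < d ∧ q.map ((σ ^ d : E ≃ₐ[F] E) : E →+* E) = q := by
    refine ⟨ℓ, hℓ, ?_⟩
    have h := map_pow_zero σ q
    rw [pow_zero, ← hσℓ] at h
    exact h
  set d := Nat.find hP with hd
  have hdpos : 0 < d := (Nat.find_spec hP).1
  have hdq : q.map ((σ ^ d : E ≃ₐ[F] E) : E →+* E) = q := (Nat.find_spec hP).2
  have hmin : ∀ m, m < d → 0 < m → q.map ((σ ^ m : E ≃ₐ[F] E) : E →+* E) ≠ q :=
    fun m hm hm0 hmq => Nat.find_min hP hm ⟨hm0, hmq⟩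
  refine ⟨d, hdpos, fun a => ⟨fun ha => ?_, fun ⟨x, hx⟩ => hx ▸ map_pow_mul_eq_self hdq x⟩⟩
  induction a using Nat.strong_induction_on with
  | _ a ih =>
    by_cases had : a < d
    · by_cases ha0 : a = 0
      · rw [ha0]
        exact dvd_zero d
      · exact absurd ha (hmin a had (Nat.pos_of_ne_zero ha0))
    · -- `a ≥ d`: `q^{σ^{a-d}} = q`
      have hle : d ≤ a := not_lt.1 had
      have h1 : q.map ((σ ^ (a - d) : E ≃ₐ[F] E) : E →+* E) = q := by
        conv_lhs => rw [← hdq]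
        rw [map_pow_map_pow, Nat.sub_add_cancel hle, ha]
      have h2 := ih (a - d) (Nat.sub_lt (lt_of_lt_of_le hdpos hle) hdpos) h1
      have h3 : a = a - d + d := (Nat.sub_add_cancel hle).symm
      rw [h3]
      exact dvd_add h2 (dvd_refl d)

/-- **The conjugates within a period are pairwise distinct**: if `q^{σ^a} = q ↔ d ∣ a` and
`σ^ℓ = 1` with `0 < ℓ`, then `j ↦ q^{σ^j}` is injective on `j < d`. [folklore] -/
theorem map_pow_injective_of_period {ℓ : ℕ} (hσℓ : σ ^ ℓ = 1) (hℓ : 0 < ℓ) {q : E[X]} {d : ℕ}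
    (hd : ∀ a : ℕ, q.map ((σ ^ a : E ≃ₐ[F] E) : E →+* E) = q ↔ d ∣ a) :
    Function.Injective fun j : Fin d => q.map ((σ ^ (j : ℕ) : E ≃ₐ[F] E) : E →+* E) := by
  have hdℓ : d ∣ ℓ := (hd ℓ).1 (by
    have h := map_pow_zero σ q
    rw [pow_zero, ← hσℓ] at h
    exact h)
  have hdpos : 0 < d := Nat.pos_of_dvd_of_pos hdℓ hℓ
  have hdle : d ≤ ℓ := Nat.le_of_dvd hℓ hdℓ
  -- the key step, for `i < j`
  have key : ∀ i j : Fin d, (i : ℕ) < j →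
      q.map ((σ ^ (i : ℕ) : E ≃ₐ[F] E) : E →+* E) =
        q.map ((σ ^ (j : ℕ) : E ≃ₐ[F] E) : E →+* E) → False := by
    intro i j hij hfij
    have hiℓ : (i : ℕ) ≤ ℓ := le_of_lt (lt_of_lt_of_le i.2 hdle)
    have h1 := congrArg (Polynomial.map ((σ ^ (ℓ - (i : ℕ)) : E ≃ₐ[F] E) : E →+* E)) hfij
    simp only [map_pow_map_pow, Nat.sub_add_cancel hiℓ] at h1
    rw [hσℓ] at h1
    have h0 : q.map ((1 : E ≃ₐ[F] E) : E →+* E) = q := by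
      have h := map_pow_zero σ q
      rwa [pow_zero] at h
    rw [h0] at h1
    -- `d ∣ ℓ - i + j`, `d ∣ ℓ = (ℓ - i) + i`, so `d ∣ j - i`
    have h2 : d ∣ ℓ - (i : ℕ) + j := (hd _).1 h1.symm
    have h3 : d ∣ ℓ - (i : ℕ) + i := by rw [Nat.sub_add_cancel hiℓ]; exact hdℓ
    have h4 : d ∣ (ℓ - (i : ℕ) + j) - (ℓ - (i : ℕ) + i) := Nat.dvd_sub h2 h3
    rw [show ℓ - (i : ℕ) + j - (ℓ - (i : ℕ) + i) = (j : ℕ) - i by omega] at h4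
    have h5 : (j : ℕ) - i = 0 := Nat.eq_zero_of_dvd_of_lt h4 (by omega)
    omega
  intro i j hfij
  rcases lt_trichotomy (i : ℕ) j with h | h | h
  · exact (key i j h hfij).elim
  · exact Fin.ext h
  · exact (key j i h hfij.symm).elim

/-- The product `∏_{j<d} q^{σ^j}` over a period is `σ`-invariant: `σ` permutes the factors
cyclically, `q^{σ^d} = q`. [folklore] -/
theorem map_prod_conj_eq_of_period {q : E[X]} {d : ℕ}
    (hdq : q.map ((σ ^ d : E ≃ₐ[F] E) : E →+* E) = q) (hq0 : q ≠ 0) :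
    (∏ j : Fin d, q.map ((σ ^ (j : ℕ) : E ≃ₐ[F] E) : E →+* E)).map (σ : E →+* E) =
      ∏ j : Fin d, q.map ((σ ^ (j : ℕ) : E ≃ₐ[F] E) : E →+* E) := by
  set f : ℕ → E[X] := fun a => q.map ((σ ^ a : E ≃ₐ[F] E) : E →+* E) with hf
  have hfσ : ∀ a, (f a).map (σ : E →+* E) = f (a + 1) := fun a => by
    have h := map_pow_map_pow σ q a 1
    rw [pow_one] at h
    rw [h, add_comm]
  have hfd : f d = f 0 := by
    rw [hf]
    dsimp only
    rw [hdq, map_pow_zero]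
  have hf0 : f 0 ≠ 0 := by
    rw [hf]
    dsimp only
    rw [map_pow_zero]
    exact hq0
  change (∏ j : Fin d, f j).map (σ : E →+* E) = ∏ j : Fin d, f j
  rw [← Finset.prod_range f, Polynomial.map_prod]
  simp_rw [hfσ]
  have h1 := Finset.prod_range_succ' f d
  have h2 := Finset.prod_range_succ f d
  rw [hfd] at h2
  exact mul_right_cancel₀ hf0 (h1.symm.trans h2)

end Period

/-! ### The intermediate field `E₁ = E^{σ^d}` -/

section Intermediate

/-- **Dedekind–Artin for an intermediate field.** Let `E₁` be an intermediate field of `E / F`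
with an `F`-basis `ε₁, …, ε_d`, and suppose the restrictions `σ^j|_{E₁}`, `j < d`, are pairwise
distinct. Then the Moore matrix `(σ^j(ε_k))_{j,k<d}` is invertible: a row relation extends
`F`-linearly to a linear relation among the distinct characters `σ^j|_{E₁} : E₁^× → E`.
[folklore] -/
theorem det_moore_ne_zero_of_intermediateField {d : ℕ} (σ : E ≃ₐ[F] E)
    (E₁ : IntermediateField F E) (ε : Basis (Fin d) F E₁)
    (hdist : ∀ i j : Fin d, (∀ e : E₁, (σ ^ (i : ℕ)) (e : E) = (σ ^ (j : ℕ)) (e : E)) → i = j) :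
    (Matrix.of fun j k : Fin d => (σ ^ (j : ℕ)) (ε k : E)).det ≠ 0 := by
  intro hdet
  obtain ⟨c, hc0, hc⟩ := Matrix.exists_vecMul_eq_zero_iff.2 hdet
  -- the row relation, extended to all of `E₁`
  have hrel : ∀ e : E₁, ∑ j : Fin d, c j * (σ ^ (j : ℕ)) (e : E) = 0 := by
    intro e
    have hk : ∀ k : Fin d, ∑ j : Fin d, c j * (σ ^ (j : ℕ)) (ε k : E) = 0 := fun k => by
      have := congrFun hc k
      simpa [Matrix.vecMul, dotProduct] using this
    have he : (e : E) = ∑ k, ε.repr e k • (ε k : E) := by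
      conv_lhs => rw [← ε.sum_repr e]
      rw [IntermediateField.coe_sum]
      refine Finset.sum_congr rfl fun k _ => ?_
      rw [IntermediateField.coe_smul]
    calc ∑ j : Fin d, c j * (σ ^ (j : ℕ)) (e : E)
        = ∑ j : Fin d, c j * (σ ^ (j : ℕ)) (∑ k, ε.repr e k • (ε k : E)) := by rw [← he]
      _ = ∑ k, ε.repr e k • ∑ j : Fin d, c j * (σ ^ (j : ℕ)) (ε k : E) := by
          simp only [map_sum, map_smul, Finset.mul_sum, Finset.smul_sum, mul_smul_comm]
          exact Finset.sum_comm
      _ = 0 := by simp only [hk, smul_zero, Finset.sum_const_zero]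
  -- the characters `σ^j|_{E₁} : E₁ →* E` are pairwise distinct, hence linearly independent
  set χ : Fin d → (E₁ →* E) := fun j =>
    ((σ ^ (j : ℕ) : E ≃ₐ[F] E) : E →* E).comp (algebraMap E₁ E : E₁ →+* E).toMonoidHom with hχ
  have hχapp : ∀ (j : Fin d) (e : E₁), χ j e = (σ ^ (j : ℕ)) (e : E) := fun j e => rfl
  have hχinj : Function.Injective χ := by
    intro i j hij
    apply hdist
    intro e
    rw [← hχapp, ← hχapp, hij]
  have hli : LinearIndependent E fun j : Fin d => (χ j : E₁ → E) :=
    (linearIndependent_monoidHom E₁ E).comp χ hχinj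
  have hc : c = 0 := by
    funext j
    refine Fintype.linearIndependent_iff.1 hli c ?_ j
    funext e
    have h := hrel e
    simpa [Finset.sum_apply, Pi.smul_apply, smul_eq_mul, hχapp] using h
  exact hc0 hc

/-- `σ^a ∈ ⟨σ^d⟩` with `d ∣ orderOf σ` forces `d ∣ a`. [folklore] -/
theorem dvd_of_pow_mem_zpowers_pow {σ : E ≃ₐ[F] E} {d a : ℕ} (hd : d ∣ orderOf σ)
    (ha : σ ^ a ∈ Subgroup.zpowers (σ ^ d)) : d ∣ a := by
  obtain ⟨z, hz⟩ := Subgroup.mem_zpowers_iff.1 ha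
  -- `σ^(d z) = σ^a` as integer powers, so `orderOf σ ∣ a - d z`
  have h1 : σ ^ ((a : ℤ) - d * z) = 1 := by
    rw [zpow_sub, zpow_mul, zpow_natCast, zpow_natCast, hz, mul_inv_cancel]
  have h2 : (orderOf σ : ℤ) ∣ (a : ℤ) - d * z := orderOf_dvd_iff_zpow_eq_one.2 h1
  have h3 : (d : ℤ) ∣ (a : ℤ) - d * z := (Int.natCast_dvd_natCast.2 hd).trans h2
  have h4 : (d : ℤ) ∣ (a : ℤ) := by
    have := dvd_add h3 (dvd_mul_right (d : ℤ) z)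
    rwa [sub_add_cancel] at this
  exact Int.natCast_dvd_natCast.1 h4

/-- **The fixed field of `σ^d`.** Let `E / F` be finite Galois with `Gal(E/F) = ⟨σ⟩` and
`0 < d ∣ [E : F]`. Then `E₁ = E^{σ^d}` is an intermediate field of degree `d` over `F` (so it
has an `F`-basis indexed by `Fin d`), it contains every element fixed by `σ^d`, and the
restrictions `σ^j|_{E₁}`, `j < d`, are pairwise distinct (`Gal(E₁/F) = ⟨σ⟩/⟨σ^d⟩`).
[folklore] -/
theorem exists_intermediateField_of_dvd [FiniteDimensional F E] [IsGalois F E] {σ : E ≃ₐ[F] E}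
    (hgen : Subgroup.zpowers σ = ⊤) {d : ℕ} (hd : 0 < d) (hdℓ : d ∣ finrank F E) :
    ∃ E₁ : IntermediateField F E, (∀ e : E, (σ ^ d) e = e → e ∈ E₁) ∧
      Nonempty (Basis (Fin d) F E₁) ∧
      ∀ i j : Fin d, (∀ e : E₁, (σ ^ (i : ℕ)) (e : E) = (σ ^ (j : ℕ)) (e : E)) → i = j := by
  classical
  have hcard : Nat.card (E ≃ₐ[F] E) = finrank F E := IsGalois.card_aut_eq_finrank F E
  have hord : orderOf σ = finrank F E := by
    rw [← hcard, ← Nat.card_zpowers σ, hgen, Subgroup.card_top]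
  have hℓ : 0 < finrank F E := finrank_pos
  have hσℓ : σ ^ finrank F E = 1 := hord ▸ pow_orderOf_eq_one σ
  set H : Subgroup (E ≃ₐ[F] E) := Subgroup.zpowers (σ ^ d) with hH
  set E₁ : IntermediateField F E := IntermediateField.fixedField H with hE₁
  refine ⟨E₁, fun e he => ?_, ?_, ?_⟩
  · -- elements fixed by `σ^d` are fixed by `⟨σ^d⟩`
    rw [hE₁, IntermediateField.mem_fixedField_iff]
    intro f hf
    have hstab : H ≤ MulAction.stabilizer (E ≃ₐ[F] E) e :=
      Subgroup.zpowers_le.2 (MulAction.mem_stabilizer_iff.2 he)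
    exact MulAction.mem_stabilizer_iff.1 (hstab hf)
  · -- `[E₁ : F] = d`
    have h1 : finrank E₁ E = finrank F E / d := by
      rw [hE₁, IntermediateField.finrank_fixedField_eq_card, hH, Nat.card_zpowers,
        orderOf_pow_of_dvd hd.ne' (hord.symm ▸ hdℓ), hord]
    have h2 := Module.finrank_mul_finrank F E₁ E
    rw [h1] at h2
    have h3 : d * (finrank F E / d) = finrank F E := Nat.mul_div_cancel' hdℓ
    have hq0 : finrank F E / d ≠ 0 := by
      intro h0
      rw [h0, mul_zero] at h3
      omega
    have h4 : finrank F E₁ = d := Nat.eq_of_mul_eq_mul_right (Nat.pos_of_ne_zero hq0)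
      (h2.trans h3.symm)
    exact ⟨Module.finBasisOfFinrankEq F E₁ h4⟩
  · -- distinct restrictions
    intro i j hij
    by_contra hne
    -- reduce to `i < j` or `j < i`
    have key : ∀ i j : Fin d, (i : ℕ) < j →
        (∀ e : E₁, (σ ^ (i : ℕ)) (e : E) = (σ ^ (j : ℕ)) (e : E)) → False := by
      intro i j hlt h
      have hdle : d ≤ finrank F E := Nat.le_of_dvd hℓ hdℓ
      have hiℓ : (i : ℕ) ≤ finrank F E := le_of_lt (lt_of_lt_of_le i.2 hdle)
      -- `σ^{ℓ - i + j}` fixes `E₁` pointwise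
      have hfix : σ ^ (finrank F E - (i : ℕ) + j) ∈ IntermediateField.fixingSubgroup E₁ := by
        rw [IntermediateField.mem_fixingSubgroup_iff]
        intro x hx
        have h1 := congrArg (σ ^ (finrank F E - (i : ℕ))) (h ⟨x, hx⟩)
        dsimp only at h1
        rw [← AlgEquiv.mul_apply, ← AlgEquiv.mul_apply, ← pow_add, ← pow_add,
          Nat.sub_add_cancel hiℓ, hσℓ, AlgEquiv.one_apply] at h1
        exact h1.symm
      rw [hE₁, IntermediateField.fixingSubgroup_fixedField] at hfix
      have h2 : d ∣ finrank F E - (i : ℕ) + j :=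
        dvd_of_pow_mem_zpowers_pow (hord.symm ▸ hdℓ) hfix
      have h3 : d ∣ finrank F E - (i : ℕ) + i := by rw [Nat.sub_add_cancel hiℓ]; exact hdℓ
      have h4 : d ∣ (finrank F E - (i : ℕ) + j) - (finrank F E - (i : ℕ) + i) :=
        Nat.dvd_sub h2 h3
      rw [show finrank F E - (i : ℕ) + j - (finrank F E - (i : ℕ) + i) = (j : ℕ) - i by omega]
        at h4
      have h5 : (j : ℕ) - i = 0 := Nat.eq_zero_of_dvd_of_lt h4 (by omega)
      omega
    rcases lt_trichotomy (i : ℕ) j with h | h | h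
    · exact key i j h hij
    · exact hne (Fin.ext h)
    · exact key j i h fun e => (hij e).symm

end Intermediate

/-! ### The block of an orbit of period `d` -/

section Block

/-- `∑_a ∑_b ∑_c = ∑_c ∑_b ∑_a`. [folklore] -/
private theorem sum_comm₃' {α β γ N : Type*} [Fintype α] [Fintype β] [Fintype γ]
    [AddCommMonoid N] (f : α → β → γ → N) :
    ∑ a, ∑ b, ∑ c, f a b c = ∑ c, ∑ b, ∑ a, f a b c := by
  rw [Finset.sum_comm]
  refine (Finset.sum_congr rfl fun b _ => Finset.sum_comm).trans ?_
  rw [Finset.sum_comm]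

variable {W : Type*} [AddCommGroup W] [Module E W] [FiniteDimensional E W]
  [Module F W] [IsScalarTower F E W]

/-- **The block of an orbit of period `d`.** Let `φ` be a bijective `σ`-semilinear map of a
finite-dimensional `E`-space `W` commuting with `T`, with `φ^ℓ = T` and `σ^ℓ = 1`. Let `E₁` be an
intermediate field with an `F`-basis `ε` indexed by `Fin d` on which the `σ^j`, `j < d`, restrict
to pairwise distinct maps, and let `q ∈ E[X]` be monic irreducible with coefficients in `E₁` whose
conjugates `qⱼ = q^{σ^j}`, `j < d`, are pairwise coprime. Then `ker (∏_{j<d} qⱼ)^k(T)` is spanned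
by a finite linearly independent set with `T`-stable `F`-span: with `Mⱼ = ker qⱼ^k(T) = φ^j(M₀)`,
`b` an `E`-basis of `M₀` in which `T` has entries in `E₁` (structure theorem over `E₁`), take
`β'_{k,i} = ∑_{j<d} σ^j(ε_k) φ^j(bᵢ)`. [folklore] -/
theorem exists_span_eq_ker_prod_conj_of_intermediateField {σ : E ≃ₐ[F] E} {ℓ d : ℕ}
    (hσℓ : σ ^ ℓ = 1) (hdℓ : d ≤ ℓ) (E₁ : IntermediateField F E) (ε : Basis (Fin d) F E₁)
    (hdist : ∀ i j : Fin d, (∀ e : E₁, (σ ^ (i : ℕ)) (e : E) = (σ ^ (j : ℕ)) (e : E)) → i = j)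
    {T : W →ₗ[E] W} {φ : W →ₛₗ[(σ : E →+* E)] W} (hφ : Function.Bijective φ)
    (hφT : ∀ w, φ (T w) = T (φ w)) (hφℓ : ∀ w, (⇑φ)^[ℓ] w = T w) {q : E[X]}
    (hq : Irreducible q) (hqm : q.Monic) (hqE₁ : ∀ n, q.coeff n ∈ Set.range (algebraMap E₁ E))
    (k : ℕ)
    (hcop : Pairwise fun i j : Fin d =>
      IsCoprime (q.map ((σ ^ (i : ℕ) : E ≃ₐ[F] E) : E →+* E))
        (q.map ((σ ^ (j : ℕ) : E ≃ₐ[F] E) : E →+* E))) :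
    ∃ S : Set W, S.Finite ∧ LinearIndepOn E id S ∧
      Submodule.span E S = LinearMap.ker
        (aeval T ((∏ j : Fin d, q.map ((σ ^ (j : ℕ) : E ≃ₐ[F] E) : E →+* E)) ^ k)) ∧
      ∀ s ∈ S, T s ∈ Submodule.span F S := by
  classical
  -- the conjugates `qj a = q^{σ^a}` (indexed by `ℕ`)
  set qj : ℕ → E[X] := fun a => q.map ((σ ^ a : E ≃ₐ[F] E) : E →+* E) with hqj
  have hqj_map : ∀ a c, (qj a).map ((σ ^ c : E ≃ₐ[F] E) : E →+* E) = qj (c + a) := by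
    intro a c
    simp only [hqj, Polynomial.map_map]
    congr 1
    ext e
    simp [pow_add, AlgEquiv.mul_apply]
  have hqj_ℓ : qj ℓ = qj 0 := by simp only [hqj, hσℓ, pow_zero]
  have hqj_0 : qj 0 = q := map_pow_zero σ q
  -- `T` is injective (`T = φ^ℓ`)
  have hTinj : Function.Injective T := by
    have : (⇑T) = (⇑φ)^[ℓ] := funext fun w => (hφℓ w).symm
    rw [this]
    exact hφ.1.iterate ℓ
  -- the submodules `M j = ker qⱼ^k(T)` and `M₀`
  set M : Fin d → Submodule E W := fun j => LinearMap.ker (aeval T (qj j ^ k)) with hM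
  set M₀ : Submodule E W := LinearMap.ker (aeval T (qj 0 ^ k)) with hM₀
  have hcopk : Pairwise fun i j : Fin d => IsCoprime (qj i ^ k) (qj j ^ k) :=
    fun i j hij => (hcop hij).pow
  have hind : iSupIndep M := iSupIndep_ker_aeval_of_pairwise_isCoprime (T := T) _ hcopk
  have hsup : ⨆ j, M j = LinearMap.ker (aeval T ((∏ j : Fin d, qj j) ^ k)) := by
    rw [← Finset.prod_pow]
    exact iSup_ker_aeval_eq_of_pairwise_isCoprime _ hcopk
  -- an `E`-basis `b` of `M₀` in which `T` has entries in `E₁`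
  have hTM₀ : ∀ v ∈ M₀, T v ∈ M₀ := fun v hv => mem_ker_aeval_of_mem _ hv
  have hrat₁ : IsRationalEnd E₁ (T.restrict hTM₀) := by
    refine isRationalEnd_of_aeval_pow_eq_zero (F := E₁) (T.restrict hTM₀) hq hqm hqE₁ (k := k) ?_
    ext v
    rw [coe_aeval_restrict_apply, LinearMap.zero_apply, ZeroMemClass.coe_zero]
    have hv : aeval T (qj 0 ^ k) (v : W) = 0 := v.2
    rwa [hqj_0] at hv
  obtain ⟨S₀, hS₀f, hS₀i, hS₀s, hS₀T⟩ := hrat₁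
  haveI : Fintype S₀ := hS₀f.fintype
  have hrange₀ : Set.range (fun s : S₀ => (s : M₀)) = S₀ := Subtype.range_coe
  set bS : Basis S₀ E M₀ := Basis.mk hS₀i (by
    change ⊤ ≤ Submodule.span E (Set.range fun s : S₀ => (s : M₀))
    rw [hrange₀, hS₀s]) with hbS
  have hbSapp : ∀ s : S₀, bS s = (s : M₀) := fun s => by
    rw [hbS, Basis.mk_apply]
    rfl
  set m := Fintype.card S₀
  set eS : S₀ ≃ Fin m := Fintype.equivFin S₀
  set b : Basis (Fin m) E M₀ := bS.reindex eS with hb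
  have hbapp : ∀ i, b i = ((eS.symm i : S₀) : M₀) := fun i => by
    rw [hb, Basis.reindex_apply, hbSapp]
  have hbrange : Set.range b = S₀ := by
    rw [hb, Basis.range_reindex]
    rw [show (⇑bS : S₀ → M₀) = fun s : S₀ => (s : M₀) from funext hbSapp, hrange₀]
  -- the matrix `U` of `T` on `M₀` in the basis `b` has entries in `E₁`
  set U : Fin m → Fin m → E := fun i' i => b.repr (T.restrict hTM₀ (b i)) i' with hU
  have hTb : ∀ i, T (b i : W) = ∑ i', U i' i • (b i' : W) := by
    intro i
    have h := congrArg (M₀.subtype : M₀ →ₗ[E] W) (b.sum_repr (T.restrict hTM₀ (b i)))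
    rw [map_sum] at h
    simp only [map_smul, Submodule.subtype_apply] at h
    exact h.symm
  have hUrat : ∀ i' i, U i' i ∈ Set.range (algebraMap E₁ E) := by
    intro i' i
    have hmem : T.restrict hTM₀ (b i) ∈ Submodule.span E₁ (Set.range b) := by
      rw [hbrange]
      apply hS₀T
      rw [← hbrange]
      exact Set.mem_range_self i
    exact (b.mem_span_iff_repr_mem E₁ _).1 hmem i'
  choose U₁ hU₁ using hUrat
  -- the family `β (j, i) = φ^j (b i) ∈ M j`
  set β : Fin d × Fin m → W := fun p => (⇑φ)^[(p.1 : ℕ)] (b p.2 : W) with hβ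
  have hβmem : ∀ (j : Fin d) (i : Fin m), β (j, i) ∈ M j := by
    intro j i
    have h := semilinear_iterate_mem_ker hφT (b i).2 (j : ℕ)
    rwa [Polynomial.map_pow, hqj_map, add_zero] at h
  -- the slices `i ↦ β (j, i)` are linearly independent
  have hbW : LinearIndependent E fun i : Fin m => (b i : W) :=
    b.linearIndependent.map' M₀.subtype M₀.ker_subtype
  have hslice : ∀ j : Fin d, LinearIndependent E fun i : Fin m => β (j, i) := fun j =>
    linearIndependent_comp_semilinear (iterateSL φ j) (hφ.1.iterate _) hbW
  -- `β` is linearly independent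
  have hβli : LinearIndependent E β := by
    have h := linearIndependent_iUnion_finite (f := fun (j : Fin d) (i : Fin m) => β (j, i))
      hslice fun j t _ hjt => by
        refine (iSupIndep_def.1 hind j).mono ?_ ?_
        · exact Submodule.span_le.2 (Set.range_subset_iff.2 fun i => hβmem j i)
        · refine iSup₂_le fun i hi => ?_
          have hij : i ≠ j := fun h => hjt (h ▸ hi)
          exact (Submodule.span_le.2 (Set.range_subset_iff.2 fun i' => hβmem i i')).trans
            (le_iSup₂_of_le i hij le_rfl)
    exact h.comp (Equiv.sigmaEquivProd (Fin d) (Fin m)).symm (Equiv.injective _)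
  -- `span β = ⊕ⱼ M j`: `M j = φ^j (M₀)`
  have hspanβ : Submodule.span E (Set.range β) = ⨆ j, M j := by
    apply le_antisymm
    · rw [Submodule.span_le]
      rintro _ ⟨⟨j, i⟩, rfl⟩
      exact (le_iSup M j) (hβmem j i)
    · refine iSup_le fun j => fun w hw => ?_
      obtain ⟨v, rfl⟩ := (hφ.2.iterate (j : ℕ)) w
      have hjℓ : (j : ℕ) ≤ ℓ := le_of_lt (lt_of_lt_of_le j.2 hdℓ)
      have hv : v ∈ M₀ := by
        have h1 := semilinear_iterate_mem_ker hφT hw (ℓ - (j : ℕ))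
        rw [Polynomial.map_pow, hqj_map, Nat.sub_add_cancel hjℓ, hqj_ℓ,
          ← Function.iterate_add_apply, Nat.sub_add_cancel hjℓ, hφℓ] at h1
        rw [hM₀, LinearMap.mem_ker]
        rw [LinearMap.mem_ker, aeval_apply_comm] at h1
        apply hTinj
        rw [h1, map_zero]
      have hvsum : v = ∑ i, (b.repr ⟨v, hv⟩ i) • (b i : W) := by
        have h := congrArg (M₀.subtype : M₀ →ₗ[E] W) (b.sum_repr ⟨v, hv⟩)
        rw [map_sum] at h
        simp only [map_smul, Submodule.subtype_apply] at h
        exact h.symm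
      rw [hvsum, show (⇑φ)^[(j : ℕ)] = ⇑(iterateSL φ j) from rfl, map_sum]
      refine Submodule.sum_mem _ fun i _ => ?_
      rw [LinearMap.map_smulₛₗ]
      exact Submodule.smul_mem _ _ (Submodule.subset_span ⟨(j, i), rfl⟩)
  -- the Moore matrix and the twisted family `β'`
  set Δ : Matrix (Fin d) (Fin d) E := Matrix.of fun j kk : Fin d => (σ ^ (j : ℕ)) (ε kk : E)
    with hΔ
  have hΔdet : Δ.det ≠ 0 := det_moore_ne_zero_of_intermediateField σ E₁ ε hdist
  set β' : Fin d × Fin m → W := fun p => ∑ j, Δ j p.1 • β (j, p.2) with hβ'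
  -- `β'` is linearly independent
  have hβ'li : LinearIndependent E β' := by
    rw [Fintype.linearIndependent_iff]
    intro c hc
    have hexp : ∑ p, c p • β' p =
        ∑ r : Fin d × Fin m, Δ.mulVec (fun kk => c (kk, r.2)) r.1 • β r := by
      simp only [hβ', Finset.smul_sum, smul_smul, Matrix.mulVec, dotProduct, Finset.sum_smul]
      rw [Fintype.sum_prod_type, Fintype.sum_prod_type]
      rw [sum_comm₃']
      refine Finset.sum_congr rfl fun j _ => Finset.sum_congr rfl fun i _ =>
        Finset.sum_congr rfl fun kk _ => ?_
      rw [mul_comm]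
    rw [hexp] at hc
    have hzero := Fintype.linearIndependent_iff.1 hβli _ hc
    -- each column `kk ↦ c (kk, i)` is killed by `Δ`, hence vanishes
    have hcol : ∀ i : Fin m, (fun kk => c (kk, i)) = 0 := by
      intro i
      by_contra hne
      exact hΔdet (Matrix.exists_mulVec_eq_zero_iff.1 ⟨_, hne, funext fun j => hzero (j, i)⟩)
    rintro ⟨kk, i⟩
    exact congrFun (hcol i) kk
  -- `span β' = span β`
  have hspanβ' : Submodule.span E (Set.range β') = Submodule.span E (Set.range β) := by
    apply Submodule.eq_of_le_of_finrank_eq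
    · rw [Submodule.span_le]
      rintro _ ⟨p, rfl⟩
      exact Submodule.sum_mem _ fun j _ =>
        Submodule.smul_mem _ _ (Submodule.subset_span ⟨(j, p.2), rfl⟩)
    · rw [finrank_span_eq_card hβ'li, finrank_span_eq_card hβli]
  -- the `F`-coordinates `Y` of the products `ε_k U_{i'i} ∈ E₁`
  set Y : Fin d × Fin m → Fin d × Fin m → F := fun r p => ε.repr (ε p.1 * U₁ r.2 p.2) r.1
    with hY
  have hεU : ∀ (kk : Fin d) (i' i : Fin m),
      (ε kk : E) * U i' i = ∑ kk', algebraMap F E (Y (kk', i') (kk, i)) * (ε kk' : E) := by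
    intro kk i' i
    have hsum : ε kk * U₁ i' i = ∑ kk', (ε.repr (ε kk * U₁ i' i) kk') • ε kk' :=
      (ε.sum_repr _).symm
    calc (ε kk : E) * U i' i = algebraMap E₁ E (ε kk * U₁ i' i) := by
          rw [map_mul, hU₁]
          rfl
      _ = algebraMap E₁ E (∑ kk', (ε.repr (ε kk * U₁ i' i) kk') • ε kk') := by rw [← hsum]
      _ = ∑ kk', algebraMap F E (Y (kk', i') (kk, i)) * (ε kk' : E) := by
          rw [map_sum]
          refine Finset.sum_congr rfl fun kk' _ => ?_
          rw [hY]
          dsimp only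
          rw [Algebra.smul_def, map_mul, ← IsScalarTower.algebraMap_apply]
          rfl
  -- the key computation: `T β'_{kk,i} = ∑ Y • β'`
  have hTβ' : ∀ p, T (β' p) = ∑ r, algebraMap F E (Y r p) • β' r := by
    rintro ⟨kk, i⟩
    have hL : T (β' (kk, i)) = ∑ j, ∑ i', ∑ kk',
        (algebraMap F E (Y (kk', i') (kk, i)) * Δ j kk') • β (j, i') := by
      simp only [hβ', map_sum, map_smul]
      refine Finset.sum_congr rfl fun j _ => ?_
      rw [hβ]
      dsimp only
      rw [← semilinear_iterate_comm hφT, hTb, show (⇑φ)^[(j : ℕ)] = ⇑(iterateSL φ j) from rfl,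
        map_sum, Finset.smul_sum]
      refine Finset.sum_congr rfl fun i' _ => ?_
      rw [LinearMap.map_smulₛₗ, smul_smul, ← Finset.sum_smul]
      congr 1
      have hΔj : ∀ kk', Δ j kk' = (σ ^ (j : ℕ)) (ε kk' : E) := fun _ => rfl
      rw [hΔj, RingHom.coe_coe, ← map_mul, hεU, map_sum]
      refine Finset.sum_congr rfl fun kk' _ => ?_
      rw [map_mul, AlgEquiv.commutes, hΔj]
    have hR : ∑ r, algebraMap F E (Y r (kk, i)) • β' r = ∑ kk', ∑ i', ∑ j,
        (algebraMap F E (Y (kk', i') (kk, i)) * Δ j kk') • β (j, i') := by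
      rw [Fintype.sum_prod_type]
      simp only [hβ', Finset.smul_sum, smul_smul]
    rw [hL, hR, sum_comm₃']
  -- conclusion
  refine ⟨Set.range β', Set.finite_range _, hβ'li.linearIndepOn_id, ?_, ?_⟩
  · rw [hspanβ', hspanβ, hsup]
  · rintro _ ⟨p, rfl⟩
    rw [hTβ']
    refine Submodule.sum_mem _ fun r _ => ?_
    rw [algebraMap_smul]
    exact Submodule.smul_mem _ _ (Submodule.subset_span ⟨r, rfl⟩)

end Block

/-! ### The descent theorem for a cyclic Galois group of arbitrary order -/

section Descent

universe u in
/-- **The descent theorem (core, by strong induction on the dimension).** See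
`isRationalEnd_of_semilinear_of_isGalois`. [folklore] -/
theorem isRationalEnd_of_semilinear_of_isGalois_aux [FiniteDimensional F E] [IsGalois F E]
    {σ : E ≃ₐ[F] E} (hgen : Subgroup.zpowers σ = ⊤) (dim : ℕ) :
    ∀ (V : Type u) [AddCommGroup V] [Module E V] [FiniteDimensional E V] [Module F V]
      [IsScalarTower F E V], finrank E V = dim →
      ∀ (T : V →ₗ[E] V) (φ : V →ₛₗ[(σ : E →+* E)] V), Function.Bijective φ →
        (∀ w, φ (T w) = T (φ w)) → (∀ w, (⇑φ)^[finrank F E] w = T w) → IsRationalEnd F T := by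
  classical
  -- `σ` has order `ℓ = [E : F]`
  have hcard : Nat.card (E ≃ₐ[F] E) = finrank F E := IsGalois.card_aut_eq_finrank F E
  have hord : orderOf σ = finrank F E := by
    rw [← hcard, ← Nat.card_zpowers σ, hgen, Subgroup.card_top]
  have hℓ : 0 < finrank F E := finrank_pos
  have hσℓ : σ ^ finrank F E = 1 := hord ▸ pow_orderOf_eq_one σ
  induction dim using Nat.strong_induction_on with
  | _ dim ih =>
  intro V _ _ _ _ _ hd T φ hφ hφT hφℓ
  rcases subsingleton_or_nontrivial V with hV | hV
  · exact IsRationalEnd.of_subsingleton T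
  -- the minimal polynomial of `T` and a monic irreducible factor `q`
  have hint : IsIntegral E T := IsIntegral.of_finite E T
  set μ := minpoly E T with hμ
  have hμT : aeval T μ = 0 := minpoly.aeval E T
  have hμmonic : μ.Monic := minpoly.monic hint
  have hμu : ¬IsUnit μ := fun hu =>
    (minpoly.degree_pos hint).ne' (Polynomial.isUnit_iff_degree_eq_zero.1 hu)
  obtain ⟨q, hqm, hq, hqμ⟩ := Polynomial.exists_monic_irreducible_factor μ hμu
  -- `ker q(T) ≠ 0`, `q` dividing the minimal polynomial
  have hkerq : LinearMap.ker (aeval T q) ≠ ⊥ := by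
    intro hbot
    obtain ⟨r, hr⟩ := hqμ
    have hrm : r.Monic := Monic.of_mul_monic_left hqm (hr ▸ hμmonic)
    have hr0 : aeval T r = 0 := by
      ext w
      have h1 : aeval T q (aeval T r w) = 0 := by
        rw [← Module.End.mul_apply, ← map_mul, ← hr, hμT, LinearMap.zero_apply]
      have h2 : aeval T r w ∈ LinearMap.ker (aeval T q) := h1
      rw [hbot, Submodule.mem_bot] at h2
      rw [h2, LinearMap.zero_apply]
    have hdeg := Polynomial.natDegree_le_natDegree (minpoly.min E T hrm hr0)
    have hdeg2 : μ.natDegree = q.natDegree + r.natDegree := by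
      rw [hr, hqm.natDegree_mul hrm]
    have hq1 : 0 < q.natDegree :=
      Polynomial.natDegree_pos_iff_degree_pos.2 (degree_pos_of_irreducible hq)
    rw [← hμ] at hdeg
    omega
  -- the conjugates of `q` are irreducible
  have hirr : ∀ c : ℕ, Irreducible (q.map ((σ ^ c : E ≃ₐ[F] E) : E →+* E)) := fun c => by
    have : q.map ((σ ^ c : E ≃ₐ[F] E) : E →+* E) =
        Polynomial.mapEquiv ((σ ^ c : E ≃ₐ[F] E) : E ≃+* E) q := rfl
    rw [this]
    exact (MulEquiv.irreducible_iff _).2 hq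
  -- the period `d` of `q`, `d ∣ ℓ`
  obtain ⟨d, hdpos, hdP⟩ := exists_period hσℓ hℓ q
  have hdq : q.map ((σ ^ d : E ≃ₐ[F] E) : E →+* E) = q := (hdP d).2 (dvd_refl d)
  have hdℓ : d ∣ finrank F E := (hdP _).1 (by
    have h := map_pow_zero σ q
    rw [pow_zero, ← hσℓ] at h
    exact h)
  have hdle : d ≤ finrank F E := Nat.le_of_dvd hℓ hdℓ
  -- the intermediate field `E₁ = E^{σ^d}`
  obtain ⟨E₁, hE₁fix, ⟨ε⟩, hdist⟩ := exists_intermediateField_of_dvd hgen hdpos hdℓ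
  have hqE₁ : ∀ n, q.coeff n ∈ Set.range (algebraMap E₁ E) := by
    intro n
    have hfixn : (σ ^ d) (q.coeff n) = q.coeff n := by
      have := congrArg (fun p => Polynomial.coeff p n) hdq
      simpa [Polynomial.coeff_map] using this
    exact ⟨⟨q.coeff n, hE₁fix _ hfixn⟩, rfl⟩
  -- the conjugates `q^{σ^j}`, `j < d`, are pairwise coprime
  have hinj := map_pow_injective_of_period hσℓ hℓ hdP
  have hcop : Pairwise fun i j : Fin d =>
      IsCoprime (q.map ((σ ^ (i : ℕ) : E ≃ₐ[F] E) : E →+* E))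
        (q.map ((σ ^ (j : ℕ) : E ≃ₐ[F] E) : E →+* E)) := fun i j hij =>
    (Irreducible.coprime_iff_not_dvd (hirr i)).2 fun hdvd => hij (hinj
      (Polynomial.eq_of_monic_of_associated (hqm.map _) (hqm.map _)
        ((hirr i).associated_of_dvd (hirr j) hdvd)))
  -- the `σ`-invariant polynomial `G = ∏_{j<d} q^{σ^j}`
  set G := ∏ j : Fin d, q.map ((σ ^ (j : ℕ) : E ≃ₐ[F] E) : E →+* E) with hG
  have hGσ : G.map (σ : E →+* E) = G := map_prod_conj_eq_of_period hdq hq.ne_zero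
  have hqG : q ∣ G := by
    have h0 : q.map ((σ ^ ((⟨0, hdpos⟩ : Fin d) : ℕ) : E ≃ₐ[F] E) : E →+* E) = q :=
      map_pow_zero σ q
    conv_lhs => rw [← h0]
    exact Finset.dvd_prod_of_mem _ (Finset.mem_univ _)
  have hkerG : LinearMap.ker (aeval T G) ≠ ⊥ := fun hbot => hkerq (by
    rw [eq_bot_iff, ← hbot]
    exact ker_aeval_le_of_dvd hqG)
  -- the induction hypothesis in the form required by the Fitting step
  have ih' : ∀ (V₂ : Submodule E V), finrank E V₂ < finrank E V →
      ∀ (hV : ∀ v ∈ V₂, T v ∈ V₂) (φV : V₂ →ₛₗ[(σ : E →+* E)] V₂), Function.Bijective φV →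
      (∀ v, φV (T.restrict hV v) = T.restrict hV (φV v)) →
      (∀ v, (⇑φV)^[finrank F E] v = T.restrict hV v) → IsRationalEnd F (T.restrict hV) :=
    fun V₂ hlt hV φV hφV hφVT hφVℓ => ih _ (hd ▸ hlt) V₂ rfl _ φV hφV hφVT hφVℓ
  refine isRationalEnd_of_fitting hφ hφT hφℓ hGσ hkerG (fun k h => ?_) ih'
  obtain ⟨S, hSf, hSi, hSspan, hST⟩ :=
    exists_span_eq_ker_prod_conj_of_intermediateField hσℓ hdle E₁ ε hdist hφ hφT hφℓ hq hqm
      hqE₁ k hcop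
  exact IsRationalEnd.restrict_of_span_eq h S hSf hSi hSspan hST

variable {W : Type*} [AddCommGroup W] [Module E W] [FiniteDimensional E W]
  [Module F W] [IsScalarTower F E W]

/-- **Descent of endomorphisms commuting with a `σ`-semilinear `ℓ`-th root, cyclic Galois case
of arbitrary order.** Let `E / F` be a finite Galois extension with `Gal(E/F) = ⟨σ⟩` of order
`ℓ = [E : F]`. If a bijective `σ`-semilinear map `φ` of a finite-dimensional `E`-space commutes
with `T` and `φ^ℓ = T`, then `T` is rational over `F`. [folklore] -/
theorem isRationalEnd_of_semilinear_of_isGalois [FiniteDimensional F E] [IsGalois F E]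
    {σ : E ≃ₐ[F] E} (hgen : Subgroup.zpowers σ = ⊤) (T : W →ₗ[E] W)
    (φ : W →ₛₗ[(σ : E →+* E)] W) (hφ : Function.Bijective φ)
    (hφT : ∀ w, φ (T w) = T (φ w)) (hφℓ : ∀ w, (⇑φ)^[finrank F E] w = T w) :
    IsRationalEnd F T :=
  isRationalEnd_of_semilinear_of_isGalois_aux hgen _ W rfl T φ hφ hφT hφℓ

end Descent

/-! ### Arthur–Clozel, Lemma 1.1 (i), existence, for cyclic extensions of arbitrary degree -/

section NormMap

open scoped MatrixGroups

variable {n : Type*} [Fintype n] [DecidableEq n]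

/-- **A rational endomorphism of `Eⁿ` is conjugate to a rational matrix**: if multiplication by
`u ∈ GL_n(E)` is rational over `F`, then `u` is conjugate in `GL_n(E)` to (the image of) an
element of `GL_n(F)` (change of basis). [folklore] -/
theorem exists_isConj_map_algebraMap_of_isRationalEnd (u : GL n E)
    (hrat : IsRationalEnd F (Matrix.toLin' (u : Matrix n n E))) :
    ∃ y : GL n F, IsConj (Matrix.GeneralLinearGroup.map (algebraMap F E) y) u := by
  classical
  set T : (n → E) →ₗ[E] (n → E) := Matrix.toLin' (u : Matrix n n E) with hT
  obtain ⟨S, hSf, hSi, hSs, hST⟩ := hrat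
  -- a basis of `Eⁿ` inside `S`, indexed by `n`
  haveI : Fintype S := hSf.fintype
  have hrange : Set.range (fun s : S => (s : n → E)) = S := Subtype.range_coe
  set bS : Basis S E (n → E) := Basis.mk hSi (by
    change ⊤ ≤ Submodule.span E (Set.range fun s : S => (s : n → E))
    rw [hrange, hSs]) with hbS
  have hbSapp : ∀ s : S, bS s = (s : n → E) := fun s => by
    rw [hbS, Basis.mk_apply]
    rfl
  have hcard : Fintype.card S = Fintype.card n := by
    rw [← Module.finrank_eq_card_basis bS, Module.finrank_fintype_fun_eq_card]
  set e : S ≃ n := Fintype.equivOfCardEq hcard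
  set b : Basis n E (n → E) := bS.reindex e with hb
  have hbapp : ∀ j, b j = ((e.symm j : S) : n → E) := fun j => by
    rw [hb, Basis.reindex_apply, hbSapp]
  have hbrange : Set.range b = S := by
    rw [hb, Basis.range_reindex]
    rw [show (⇑bS : S → n → E) = fun s : S => (s : n → E) from funext hbSapp, hrange]
  -- the matrix of `T` in the basis `b` has entries in `F`
  have hentries : ∀ i j, LinearMap.toMatrix b b T i j ∈ Set.range (algebraMap F E) := by
    intro i j
    rw [LinearMap.toMatrix_apply]
    have hmem : T (b j) ∈ Submodule.span F (Set.range b) := by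
      rw [hbrange, hbapp]
      exact hST _ (e.symm j).2
    exact (b.mem_span_iff_repr_mem F (T (b j))).1 hmem i
  choose c hc using hentries
  set Y' : Matrix n n F := Matrix.of fun i j => c i j with hY'
  have hY : (Y'.map (algebraMap F E) : Matrix n n E) = LinearMap.toMatrix b b T := by
    ext i j
    simp [hY', hc]
  -- change of basis: `A Y A' = u`
  set A : Matrix n n E := (Pi.basisFun E n).toMatrix b with hA
  set A' : Matrix n n E := b.toMatrix (Pi.basisFun E n) with hA'
  have hAA' : A * A' = 1 := Basis.toMatrix_mul_toMatrix_flip _ _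
  have hA'A : A' * A = 1 := Basis.toMatrix_mul_toMatrix_flip _ _
  have hconj : A * LinearMap.toMatrix b b T * A' = (u : Matrix n n E) := by
    rw [hA, hA', basis_toMatrix_mul_linearMap_toMatrix_mul_basis_toMatrix,
      LinearMap.toMatrix_eq_toMatrix', hT, LinearMap.toMatrix'_toLin']
  -- `det Y' ≠ 0`
  have hdetY : Y'.det ≠ 0 := by
    intro h0
    have h1 : (LinearMap.toMatrix b b T).det = 0 := by
      rw [← hY, ← RingHom.mapMatrix_apply, ← RingHom.map_det, h0, map_zero]
    have h2 : (u : Matrix n n E).det = 0 := by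
      rw [← hconj, Matrix.det_mul, Matrix.det_mul, h1, mul_zero, zero_mul]
    exact (Matrix.isUnit_iff_isUnit_det (u : Matrix n n E) |>.1 u.isUnit).ne_zero h2
  -- conclusion
  set AU : GL n E := ⟨A, A', hAA', hA'A⟩ with hAU
  refine ⟨Matrix.GeneralLinearGroup.mkOfDetNeZero Y' hdetY, isConj_iff.2 ⟨AU, ?_⟩⟩
  apply Units.ext
  simp only [Units.val_mul]
  rw [← hconj, ← hY]
  congr 1

/-- **Arthur–Clozel, Ch. 1, Lemma 1.1 (i), existence clause, for a cyclic extension of arbitrary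
degree** (following Langlands, *Base change for `GL(2)`*, §4): let `E / F` be a finite Galois
extension whose group is cyclic, generated by `σ`, of order `ℓ = [E : F]` — *"we do not assume
that `ℓ` is prime"*. Then for every `x ∈ GL_n(E)` the norm `N x = x x^σ x^{σ²} ⋯ x^{σ^{ℓ-1}}` is
conjugate in `GL_n(E)` to an element `y` of `GL_n(F)` (unique up to `GL_n(F)`-conjugacy by
`isConj_of_isConj_map_algebraMap`). This removes the primality hypothesis of
`exists_isConj_map_algebraMap_normMap`. [cite: ArthurClozelAMS120, Ch. 1, Lemma 1.1] -/
theorem exists_isConj_map_algebraMap_normMap_of_isGalois [FiniteDimensional F E] [IsGalois F E]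
    {σ : E ≃ₐ[F] E} (hgen : Subgroup.zpowers σ = ⊤) (x : GL n E) :
    ∃ y : GL n F,
      IsConj (Matrix.GeneralLinearGroup.map (algebraMap F E) y) (normMap σ (finrank F E) x) := by
  classical
  have hcard : Nat.card (E ≃ₐ[F] E) = finrank F E := IsGalois.card_aut_eq_finrank F E
  have hord : orderOf σ = finrank F E := by
    rw [← hcard, ← Nat.card_zpowers σ, hgen, Subgroup.card_top]
  have hσℓ : σ ^ finrank F E = 1 := hord ▸ pow_orderOf_eq_one σ
  set u : GL n E := normMap σ (finrank F E) x with hu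
  refine exists_isConj_map_algebraMap_of_isRationalEnd u ?_
  exact isRationalEnd_of_semilinear_of_isGalois hgen _ (twistFrob σ x) (twistFrob_bijective σ x)
    (fun w => by
      rw [Matrix.toLin'_apply, Matrix.toLin'_apply]
      exact twistFrob_mulVec_normMap hσℓ x w)
    (fun w => by
      rw [Matrix.toLin'_apply]
      exact twistFrob_iterate_of_pow_eq_one hσℓ x w)

end NormMap

end ArthurClozel

end Literature.NumberTheory.Automorphic
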